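import Literature.NumberTheory.Automorphic.RestrictedTensorProductExistenceProofs
import HarnessLib

/-!
# Restricted tensor products: the explicit universal map, functoriality, and the induced
representation on an arbitrary model

Topic `NumberTheory/Automorphic`. The statement file
`Literature/NumberTheory/Automorphic/RestrictedTensorProduct.lean` characterises a restricted
tensor product `(W, j)` of a family `(V i, x₀ i)` by the predicate
`IsRestrictedTensorProduct k j S₀`, and `RestrictedTensorProductProofs` proves the universal
property in the form `∃ F : W →ₗ[k] W', ∀ x, F (j x) = j' x` (`exists_linearMap_apply_eq`) with
uniqueness (`linearMap_ext`). For *constructions* on a concrete model `W` (e.g. a space of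
functions on an adelic space, `RestrictedTensorProductFunctions`) one needs the universal map as a
**definition**, not an existential. This file provides, sorry-free and without any appeal to
choice on an existential:

* `IsRestrictedTensorProduct.lift h hj' : W →ₗ[k] W'` — the explicit universal map (the formula
  of the proof of `exists_linearMap_apply_eq`: `W ≃ (RestrictedFamily V x₀ →₀ k) ⧸ ker` and
  `Submodule.liftQ`), with `lift_apply : lift (j x) = j' x` and uniqueness `eq_lift`;
* `RestrictedFamily.piMap A hA` — a family of linear maps `A i : V i → V' i` carrying base vectors
  to base vectors for almost all `i` acts on restricted families, and
  `IsRestrictedTensorProduct.map` — the induced map `⊗' A i : W → W'` between ANY two models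
  (`map_apply`, `map_id`, `map_comp_map`);
* `IsRestrictedTensorProduct.rep h ρ hx₀` — for representations `ρ i` of groups `G i` on `V i`
  with `x₀ i` fixed by `K i` for almost all `i`, the representation `⊗' ρ i` of the restricted
  product group `Πʳ i, [G i, K i]` on ANY model `W` (`rep_apply : rep g (j x) = j (g • x)`), the
  certificate `isRestrictedTensorProductRep_rep : IsRestrictedTensorProductRep ρ (rep …) hx₀ j S₀`,
  and uniqueness `eq_rep` of such a representation on the model.

Sources. Flath 1979, §2 (universal property of `lim_S ⨂_{i∈S} V i`; Example 2: representations
of restricted products); Bump 1997, §3.3, pp. 293–294 and §3.4 (the representation `⊗_v π_v` of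
the restricted product on the restricted tensor product). Everything here is a formal consequence
of the tree's predicate. [folklore]

All declarations are in `namespace Literature.NumberTheory.Automorphic`.
-/

open scoped RestrictedProduct TensorProduct
open Filter PiTensorProduct Function

namespace Literature.NumberTheory.Automorphic

universe u uk uG v v' v'' w w' w''

/-! ### The explicit universal map -/

section Lift

variable {ι : Type u} {k : Type uk} [CommRing k] {V : ι → Type v} [∀ i, AddCommGroup (V i)]
  [∀ i, Module k (V i)] {x₀ : ∀ i, V i} {W : Type w} [AddCommGroup W] [Module k W]
  {W' : Type w'} [AddCommGroup W'] [Module k W'] [DecidableEq ι]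
  {j : RestrictedFamily V x₀ → W} {j' : RestrictedFamily V x₀ → W'} {S₀ : Finset ι}

namespace IsRestrictedTensorProduct

/-- In a restricted tensor product `(W, j)` every vector is a finite linear combination of values
`j x` (`Finsupp.linearCombination k j` is onto). [folklore] -/
theorem surjective_linearCombination (h : IsRestrictedTensorProduct k j S₀) :
    Surjective (Finsupp.linearCombination k j) := by
  rw [← LinearMap.range_eq_top, Finsupp.range_linearCombination]
  exact h.span_range_eq_top

/-- The linear relations among the `j x` are respected by every restricted-multilinear `j'`
(the computation behind the universal property: a relation involves finitely many families, all
equal to the base family off one finite `S ⊇ S₀`, and is the image under the injective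
`liftFinset S` of a relation in `⨂_{i ∈ S} V i`). (Flath 1979, §2.) [cite: Flath1979, §2] -/
theorem ker_linearCombination_le (h : IsRestrictedTensorProduct k j S₀)
    (hj' : IsRestrictedMultilinear k j') :
    LinearMap.ker (Finsupp.linearCombination k j) ≤
      LinearMap.ker (Finsupp.linearCombination k j') := by
  intro f hf
  rw [LinearMap.mem_ker] at hf ⊢
  obtain ⟨S, hS₀, hS⟩ := RestrictedFamily.exists_finset_forall_apply_eq S₀ f.support
  have ht : (f.sum fun x a => a • tprod k fun i : S => x i) = 0 :=
    h.injective_liftFinset hS₀ (by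
      rw [h.isRestrictedMultilinear.liftFinset_sum_smul_tprod S f hS, map_zero]
      exact hf)
  rw [← hj'.liftFinset_sum_smul_tprod S f hS, ht, map_zero]

/-- **The universal map of a restricted tensor product**, explicitly: for a restricted tensor
product `(W, j)` and a restricted-multilinear `j' : RestrictedFamily V x₀ → W'`, the linear map
`W →ₗ[k] W'` with `j x ↦ j' x`, defined as `Σ aₓ j x ↦ Σ aₓ j' x` through
`W ≃ (RestrictedFamily V x₀ →₀ k) ⧸ ker (Σ aₓ j x)` (`LinearMap.quotKerEquivOfSurjective`) and
`Submodule.liftQ` (`ker_linearCombination_le`). This is the map whose existence is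
`exists_linearMap_apply_eq`. (Flath 1979, §2; Bump 1997, §3.3.) [cite: Flath1979, §2] -/
noncomputable def lift (h : IsRestrictedTensorProduct k j S₀) (hj' : IsRestrictedMultilinear k j') :
    W →ₗ[k] W' :=
  (LinearMap.ker (Finsupp.linearCombination k j)).liftQ (Finsupp.linearCombination k j')
      (h.ker_linearCombination_le hj') ∘ₗ
    ((Finsupp.linearCombination k j).quotKerEquivOfSurjective
      h.surjective_linearCombination).symm.toLinearMap

/-- The universal map sends `j x` to `j' x`. [folklore] -/
@[simp] theorem lift_apply (h : IsRestrictedTensorProduct k j S₀)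
    (hj' : IsRestrictedMultilinear k j') (x : RestrictedFamily V x₀) :
    h.lift hj' (j x) = j' x := by
  have hx : j x = Finsupp.linearCombination k j (Finsupp.single x 1) := by simp
  rw [lift, hx, LinearMap.comp_apply, LinearEquiv.coe_toLinearMap,
    LinearMap.quotKerEquivOfSurjective_symm_apply, Submodule.liftQ_apply]
  simp

/-- Uniqueness: a linear map with `F (j x) = j' x` for all `x` is the universal map. [folklore] -/
theorem eq_lift (h : IsRestrictedTensorProduct k j S₀) (hj' : IsRestrictedMultilinear k j')
    {F : W →ₗ[k] W'} (hF : ∀ x, F (j x) = j' x) : F = h.lift hj' :=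
  h.linearMap_ext fun x => by rw [hF, lift_apply]

/-- The universal map for `j' = j` is the identity. [folklore] -/
@[simp] theorem lift_self (h : IsRestrictedTensorProduct k j S₀) :
    h.lift h.isRestrictedMultilinear = LinearMap.id :=
  (h.eq_lift (F := LinearMap.id) h.isRestrictedMultilinear fun _ => rfl).symm

end IsRestrictedTensorProduct

end Lift

/-! ### Functoriality in the local spaces -/

section Map

variable {ι : Type u} {k : Type uk} [CommRing k] {V : ι → Type v} [∀ i, AddCommGroup (V i)]
  [∀ i, Module k (V i)] {x₀ : ∀ i, V i} {V' : ι → Type v'} [∀ i, AddCommGroup (V' i)]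
  [∀ i, Module k (V' i)] {x₀' : ∀ i, V' i} {V'' : ι → Type v''} [∀ i, AddCommGroup (V'' i)]
  [∀ i, Module k (V'' i)] {x₀'' : ∀ i, V'' i}

/-- A family of linear maps `A i : V i → V' i` with `A i (x₀ i) = x₀' i` for almost all `i` acts
coordinatewise on restricted families. (Flath 1979, §2: the maps `⊗ A_v` between restricted
tensor products.) [cite: Flath1979, §2] -/
def RestrictedFamily.piMap (A : ∀ i, V i →ₗ[k] V' i) (hA : ∀ᶠ i in cofinite, A i (x₀ i) = x₀' i)
    (x : RestrictedFamily V x₀) : RestrictedFamily V' x₀' :=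
  RestrictedProduct.mk (fun i => A i (x i)) <|
    (hA.and x.eventually_eq).mono fun i hi => by rw [Set.mem_singleton_iff, hi.2, hi.1]

/-- Coordinates of `piMap`. [folklore] -/
@[simp] theorem RestrictedFamily.piMap_apply (A : ∀ i, V i →ₗ[k] V' i)
    (hA : ∀ᶠ i in cofinite, A i (x₀ i) = x₀' i) (x : RestrictedFamily V x₀) (i : ι) :
    RestrictedFamily.piMap A hA x i = A i (x i) := rfl

/-- `piMap` of a composite family. [folklore] -/
theorem RestrictedFamily.piMap_piMap (A : ∀ i, V i →ₗ[k] V' i)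
    (hA : ∀ᶠ i in cofinite, A i (x₀ i) = x₀' i) (B : ∀ i, V' i →ₗ[k] V'' i)
    (hB : ∀ᶠ i in cofinite, B i (x₀' i) = x₀'' i)
    (hBA : ∀ᶠ i in cofinite, (B i ∘ₗ A i) (x₀ i) = x₀'' i) (x : RestrictedFamily V x₀) :
    RestrictedFamily.piMap B hB (RestrictedFamily.piMap A hA x) =
      RestrictedFamily.piMap (fun i => B i ∘ₗ A i) hBA x := by
  ext i; rfl

/-- `piMap` of the identity family. [folklore] -/
@[simp] theorem RestrictedFamily.piMap_id (h : ∀ᶠ i in cofinite, LinearMap.id (R := k) (x₀ i) = x₀ i)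
    (x : RestrictedFamily V x₀) :
    RestrictedFamily.piMap (fun _ => LinearMap.id) h x = x := by
  ext i; rfl

variable [DecidableEq ι]

/-- `piMap` commutes with updating a coordinate. [folklore] -/
theorem RestrictedFamily.piMap_update (A : ∀ i, V i →ₗ[k] V' i)
    (hA : ∀ᶠ i in cofinite, A i (x₀ i) = x₀' i) (x : RestrictedFamily V x₀) (i : ι) (v : V i) :
    RestrictedFamily.piMap A hA (x.update i v) =
      (RestrictedFamily.piMap A hA x).update i (A i v) := by
  ext i'
  by_cases hi : i' = i
  · subst hi
    simp
  · simp [Function.update_of_ne hi]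

variable {W : Type w} [AddCommGroup W] [Module k W] {W' : Type w'} [AddCommGroup W'] [Module k W']
  {W'' : Type w''} [AddCommGroup W''] [Module k W'']
  {j : RestrictedFamily V x₀ → W} {j' : RestrictedFamily V' x₀' → W'}
  {j'' : RestrictedFamily V'' x₀'' → W''} {S₀ S₀' : Finset ι}

/-- Precomposing a restricted-multilinear map with `piMap A` is restricted-multilinear.
[folklore] -/
theorem IsRestrictedMultilinear.comp_piMap (hj' : IsRestrictedMultilinear k j')
    (A : ∀ i, V i →ₗ[k] V' i) (hA : ∀ᶠ i in cofinite, A i (x₀ i) = x₀' i) :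
    IsRestrictedMultilinear k (fun x => j' (RestrictedFamily.piMap A hA x)) where
  map_update_add x i v w := by
    simp only [RestrictedFamily.piMap_update, map_add, hj'.map_update_add]
  map_update_smul x i c v := by
    simp only [RestrictedFamily.piMap_update, map_smul, hj'.map_update_smul]

/-- **Functoriality of the restricted tensor product**: linear maps `A i : V i → V' i` preserving
the base vectors for almost all `i` induce `⊗' A i : W → W'` between any restricted tensor product
`(W, j)` of the `(V i, x₀ i)` and any target `(W', j')` with `j'` restricted-multilinear:
`j x ↦ j' (A • x)`. (Flath 1979, §2.) [cite: Flath1979, §2] -/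
noncomputable def IsRestrictedTensorProduct.map (h : IsRestrictedTensorProduct k j S₀)
    (hj' : IsRestrictedMultilinear k j') (A : ∀ i, V i →ₗ[k] V' i)
    (hA : ∀ᶠ i in cofinite, A i (x₀ i) = x₀' i) : W →ₗ[k] W' :=
  h.lift (hj'.comp_piMap A hA)

/-- `⊗' A i` on the values `j x`. [folklore] -/
@[simp] theorem IsRestrictedTensorProduct.map_apply (h : IsRestrictedTensorProduct k j S₀)
    (hj' : IsRestrictedMultilinear k j') (A : ∀ i, V i →ₗ[k] V' i)
    (hA : ∀ᶠ i in cofinite, A i (x₀ i) = x₀' i) (x : RestrictedFamily V x₀) :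
    h.map hj' A hA (j x) = j' (RestrictedFamily.piMap A hA x) :=
  h.lift_apply _ x

/-- `⊗'` of the identity maps is the identity. [folklore] -/
@[simp] theorem IsRestrictedTensorProduct.map_id (h : IsRestrictedTensorProduct k j S₀)
    (hA : ∀ᶠ i in cofinite, LinearMap.id (R := k) (x₀ i) = x₀ i) :
    h.map h.isRestrictedMultilinear (fun _ => LinearMap.id) hA = LinearMap.id :=
  (h.eq_lift (F := LinearMap.id) _ fun x => by
    rw [LinearMap.id_apply, RestrictedFamily.piMap_id]).symm

/-- `⊗'` is compatible with composition. [folklore] -/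
theorem IsRestrictedTensorProduct.map_comp_map (h : IsRestrictedTensorProduct k j S₀)
    (h' : IsRestrictedTensorProduct k j' S₀') (hj'' : IsRestrictedMultilinear k j'')
    (A : ∀ i, V i →ₗ[k] V' i) (hA : ∀ᶠ i in cofinite, A i (x₀ i) = x₀' i)
    (B : ∀ i, V' i →ₗ[k] V'' i) (hB : ∀ᶠ i in cofinite, B i (x₀' i) = x₀'' i)
    (hBA : ∀ᶠ i in cofinite, (B i ∘ₗ A i) (x₀ i) = x₀'' i) :
    h'.map hj'' B hB ∘ₗ h.map h'.isRestrictedMultilinear A hA =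
      h.map hj'' (fun i => B i ∘ₗ A i) hBA :=
  h.eq_lift _ fun x => by
    rw [LinearMap.comp_apply, h.map_apply, h'.map_apply, RestrictedFamily.piMap_piMap]

end Map

/-! ### The representation of the restricted product group on an arbitrary model -/

section Rep

variable {ι : Type u} {k : Type uk} [CommRing k] {G : ι → Type uG} [∀ i, Group (G i)]
  {K : ∀ i, Subgroup (G i)} {V : ι → Type v} [∀ i, AddCommGroup (V i)] [∀ i, Module k (V i)]
  (ρ : ∀ i, Representation k (G i) (V i)) {x₀ : ∀ i, V i} [DecidableEq ι]
  {W : Type w} [AddCommGroup W] [Module k W] {j : RestrictedFamily V x₀ → W} {S₀ : Finset ι}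

/-- **The restricted tensor product representation on an arbitrary model.** If `(W, j)` is a
restricted tensor product of the `(V i, x₀ i)` and the base vectors are `K i`-fixed for almost
all `i`, then `g = (g i) ∈ Πʳ i, [G i, K i]` acts on `W` by the universal map induced by the
restricted-multilinear `x ↦ j (g • x)`, `(g • x) i = ρ i (g i) (x i)`; this is a representation
(`one_smul`, `mul_smul` and uniqueness). (Flath 1979, §2, Example 2; Bump 1997, §3.4.)
[cite: Flath1979, §2  Example 2] -/
noncomputable def IsRestrictedTensorProduct.rep (h : IsRestrictedTensorProduct k j S₀)
    (hx₀ : ∀ᶠ i in cofinite, x₀ i ∈ (ρ i).fixedPoints (K i)) :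
    Representation k (Πʳ i, [G i, K i]) W where
  toFun g := h.lift (h.isRestrictedMultilinear.comp_smul ρ hx₀ g)
  map_one' := h.linearMap_ext fun x => by
    rw [h.lift_apply, RestrictedFamily.one_smul, Module.End.one_apply]
  map_mul' g g' := h.linearMap_ext fun x => by
    rw [h.lift_apply, RestrictedFamily.mul_smul, Module.End.mul_apply, h.lift_apply,
      h.lift_apply]

/-- Unfolding lemma: `rep g` is the universal map for `x ↦ j (g • x)`. [folklore] -/
theorem IsRestrictedTensorProduct.rep_def (h : IsRestrictedTensorProduct k j S₀)
    (hx₀ : ∀ᶠ i in cofinite, x₀ i ∈ (ρ i).fixedPoints (K i)) (g : Πʳ i, [G i, K i]) :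
    h.rep ρ hx₀ g = h.lift (h.isRestrictedMultilinear.comp_smul ρ hx₀ g) := rfl

/-- `g • j x = j (g • x)`. [folklore] -/
@[simp] theorem IsRestrictedTensorProduct.rep_apply (h : IsRestrictedTensorProduct k j S₀)
    (hx₀ : ∀ᶠ i in cofinite, x₀ i ∈ (ρ i).fixedPoints (K i)) (g : Πʳ i, [G i, K i])
    (x : RestrictedFamily V x₀) :
    h.rep ρ hx₀ g (j x) = j (RestrictedFamily.smul ρ hx₀ g x) := by
  rw [h.rep_def]
  exact h.lift_apply _ x

/-- `(W, ⊗' ρ i, j)` **is a restricted tensor product of the representations `ρ i`** in the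
sense of the tree's predicate `IsRestrictedTensorProductRep` (same exceptional set). [folklore] -/
theorem IsRestrictedTensorProduct.isRestrictedTensorProductRep_rep
    (h : IsRestrictedTensorProduct k j S₀)
    (hx₀ : ∀ᶠ i in cofinite, x₀ i ∈ (ρ i).fixedPoints (K i)) :
    IsRestrictedTensorProductRep ρ (h.rep ρ hx₀) hx₀ j S₀ :=
  ⟨h, fun g x => (h.rep_apply ρ hx₀ g x).symm⟩

/-- Uniqueness of the representation on the model: any `π` making `(W, π, j)` a restricted
tensor product of the `ρ i` (i.e. with `j` equivariant) is `⊗' ρ i`. [folklore] -/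
theorem IsRestrictedTensorProductRep.eq_rep {π : Representation k (Πʳ i, [G i, K i]) W}
    {hx₀ : ∀ᶠ i in cofinite, x₀ i ∈ (ρ i).fixedPoints (K i)}
    (hπ : IsRestrictedTensorProductRep ρ π hx₀ j S₀) :
    π = hπ.isRestrictedTensorProduct.rep ρ hx₀ :=
  MonoidHom.ext fun g => by
    rw [hπ.isRestrictedTensorProduct.rep_def]
    exact hπ.isRestrictedTensorProduct.eq_lift _ fun x => (hπ.2 g x).symm

end Rep

end Literature.NumberTheory.Automorphic
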